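import Mathlib
import HarnessLib
import Summits.NavierStokesRegularity.NavierStokesRegularity.Theorems.HalfSpaceWindowDoorCirculationCarryingRigidityConeFluxSubsolution
import Summits.NavierStokesRegularity.NavierStokesRegularity.Theorems.AxisTwistDoorAveragedConeLiouvilleFlatFlux
import Summits.NavierStokesRegularity.NavierStokesRegularity.Theorems.AxisTwistDoorAveragedConeLiouvilleCircleCalculus

/-!
# Route `HalfSpaceWindowDoor`, crux `CirculationCarryingRigidity` (stmt-NavierStokesRegularity-25311) —
# line `cone_sweep`, Step 3: SUPPORT RIGIDITY — a coned profile with a SATURATED plane vanishes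

LEAD ns-hsw-p1 g9 (cell pub-ns-dss), `--supports stmt-NavierStokesRegularity-25311 --as helper`; card `Cruxes/…/Lines/cone_sweep.md`.

Kinematics of the cone `‖ω_h‖ ≤ Kω₃` for the axis circulation `Γ(r,z,s) = circ` of a door-class slice: `∂ᵣΓ = ∮ω₃ dl ≥ 0`,
`∂_zΓ = −∮ω_ρ dl` and `|∮ω_ρ dl| ≤ ∮|ω_h| dl ≤ K∮ω₃ dl` (`abs_radVortCirc_le`), so along the cone lines `h ↦ (R + Kh, z₀ ± h)` the
circulation is NON-DECREASING (`circ_coneLine_mono_up/down`: vortex tubes of slope `≥ 1/K` cannot lose flux while widening at slope `K`).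
Consequently (`eq_zero_of_saturated`): if on ONE slice `s₀` the disc `D(R, z₀)` already carries the maximal circulation `S` of the slice
(`Γ(R,z₀,s₀) = S ≥ Γ(r,z,s₀)` for all `r, z`), then `Γ(·, z, s₀) ≡ S` beyond `R + K|z − z₀|` at every height, the vorticity vanishes on the
open region `{r > R + K|z−z₀|}` (`curl_eq_zero_on_circle_of_const`, the tree's `…FlatFlux` circle tool with a constant in place of `0`), and
ONE slice with an open vorticity-free set kills a door-class profile (tree `eq_zero_of_curl_eq_zero_on_open`, analyticity): `v ≡ 0`.
This is the rigidity input of Step 4 (`…ConeLiouville`), where the saturated plane is produced by the sweeping lemma and compactness.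

WHAT THIS IS NOT: not a statement about Navier–Stokes regularity; door statements concern HYPOTHETICAL blow-up profiles (KNSS ancient mild
solutions).  No item is closed by this file.
-/

noncomputable section

-- the summit and its single sub-problem share the name (CONVENTIONS §1), as in every Theorems file
set_option linter.dupNamespace false

namespace Summit.NavierStokesRegularity.NavierStokesRegularity.Theorems.HalfSpaceWindowDoorCirculationCarryingRigidityConeSupportRigidity

open MeasureTheory Set Function Filter Topology InnerProductSpace
open scoped RealInnerProductSpace InnerProductSpace
open Literature.Analysis Literature.Analysis.FluidPDE Literature.Analysis.UnboundedOperators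
open Summit.NavierStokesRegularity.NavierStokesRegularity.Theses.HalfSpaceWindowDoor
open Summit.NavierStokesRegularity.NavierStokesRegularity.Theorems.HalfSpaceWindowDoorCirculationCarryingRigidityDefs
  (InDoorClass SignE3 e3)
open Summit.NavierStokesRegularity.NavierStokesRegularity.Theorems.AxisTwistDoorAveragedConeLiouvilleDefs
  (cylPt eT eR circ vortCirc radVortCirc tiltCirc)
open Summit.NavierStokesRegularity.NavierStokesRegularity.Theorems.AveragedConeLiouville.CircleStokes
  (hasDerivAt_circ deriv_circ_eq_vortCirc inner_e3)
open Summit.NavierStokesRegularity.NavierStokesRegularity.Theorems.AveragedConeLiouville.CircleCalculus (hasDerivAt_circ_z)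
open Summit.NavierStokesRegularity.NavierStokesRegularity.Theorems.AveragedConeLiouville.CircMonotone
  (circ_zero circ_mono circ_nonneg vortCirc_nonneg)
open Summit.NavierStokesRegularity.NavierStokesRegularity.Theorems.AveragedConeLiouville.FlatFlux
  (eq_zero_of_integral_eq_zero_of_nonneg exists_cylPt_eq)
open Summit.NavierStokesRegularity.NavierStokesRegularity.Theorems.AxisTwistDoorAveragedConeLiouvilleCylFrame
  (continuous_cylPt_θ continuous_horizontal abs_inner_eR_le_norm_horizontal)
open Summit.NavierStokesRegularity.NavierStokesRegularity.Theorems.HalfSpaceWindowDoorCirculationCarryingRigidityAxisCirculation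
  (contDiffOn_circ isSmoothSpaceTimeOn_of_class)
open Summit.NavierStokesRegularity.NavierStokesRegularity.Theorems.PoloidalWindowDoorPoloidalWindowRigiditySymmetryGerms
  (eq_zero_of_curl_eq_zero_on_open)
open Summit.NavierStokesRegularity.NavierStokesRegularity.Theorems.HalfSpaceWindowDoorCirculationCarryingRigidityConeFluxSubsolution
  (signE3_atd contDiff_one_slice tiltCirc_le_of_cone norm_horizontalPart)

variable {C : ℝ} {v : ℝ → EuclideanSpace ℝ (Fin 3) → EuclideanSpace ℝ (Fin 3)}

/-! ### The radial-vorticity circle integral is dominated by the tilt -/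

/-- `|∮ω_ρ dl| ≤ ∮|ω_h| dl` (`|⟪ω, e_ρ⟫| ≤ ‖ω_h‖`). -/
theorem abs_radVortCirc_le {s : ℝ} (hv1 : ContDiff ℝ 1 (v s)) {r : ℝ} (hr : 0 ≤ r) (z : ℝ) :
    |radVortCirc v r z s| ≤ tiltCirc v r z s := by
  have hωc : Continuous fun θ => curl (v s) (cylPt r θ z) := by
    have hD : Continuous (fderiv ℝ (v s)) := hv1.continuous_fderiv one_ne_zero
    have e : curl (v s) = fun x => curlCLM (fderiv ℝ (v s) x) := by funext x; exact curl_eq_curlCLM (v s) x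
    rw [e]
    exact (curlCLM.continuous.comp hD).comp (continuous_cylPt_θ r z)
  unfold radVortCirc tiltCirc
  have h1 : |∫ θ in (0 : ℝ)..(2 * Real.pi), ⟪curl (v s) (cylPt r θ z), eR θ⟫ * r| ≤
      ∫ θ in (0 : ℝ)..(2 * Real.pi), |⟪curl (v s) (cylPt r θ z), eR θ⟫ * r| :=
    intervalIntegral.abs_integral_le_integral_abs (by positivity)
  refine h1.trans (intervalIntegral.integral_mono_on (by positivity) ?_ ?_ fun θ _ => ?_)
  · exact (((hωc.inner (Summit.NavierStokesRegularity.NavierStokesRegularity.Theorems.AveragedConeLiouville.CircleStokes.continuous_eR)).mul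
      continuous_const).abs).intervalIntegrable _ _
  · exact (((continuous_horizontal.comp hωc).norm).mul continuous_const).intervalIntegrable _ _
  · rw [abs_mul, abs_of_nonneg hr]
    exact mul_le_mul_of_nonneg_right (abs_inner_eR_le_norm_horizontal _ θ) hr

/-! ### Monotonicity of `Γ` along the cone lines -/

/-- Joint derivative of `(r,z) ↦ Γ(r,z,s)` along an affine curve `h ↦ (R + Kh, z₀ + εh)`:
`d/dh Γ(R + Kh, z₀ + εh, s) = K·∮ω₃ dl − ε·∮ω_ρ dl`. -/
theorem hasDerivAt_circ_line (hv : InDoorClass C v) {s : ℝ} (hs : s < 0) (R K z₀ ε h : ℝ) :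
    HasDerivAt (fun h' => circ v (R + K * h') (z₀ + ε * h') s)
      (K * vortCirc v (R + K * h) (z₀ + ε * h) s - ε * radVortCirc v (R + K * h) (z₀ + ε * h) s) h := by
  have hsm := isSmoothSpaceTimeOn_of_class hv.1 hv.2.1 hv.2.2.1 hv.2.2.2
  have hv1 := contDiff_one_slice hv hs
  set F : ℝ × ℝ × ℝ → ℝ := fun q => circ v q.1 q.2.1 q.2.2 with hF
  have hFc : ContDiffOn ℝ 2 F {q | q.2.2 < 0} := contDiffOn_circ hsm
  set r : ℝ := R + K * h with hr
  set z : ℝ := z₀ + ε * h with hz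
  have hopen : IsOpen {q : ℝ × ℝ × ℝ | q.2.2 < 0} := isOpen_lt (continuous_snd.comp continuous_snd) continuous_const
  have hmem : ((r, z, s) : ℝ × ℝ × ℝ) ∈ {q : ℝ × ℝ × ℝ | q.2.2 < 0} := hs
  have hdiff : DifferentiableAt ℝ F (r, z, s) :=
    (hFc.differentiableOn (by norm_num)).differentiableAt (hopen.mem_nhds hmem)
  set L := fderiv ℝ F (r, z, s) with hL
  -- the partial derivatives
  have hcr : HasDerivAt (fun r' : ℝ => ((r', z, s) : ℝ × ℝ × ℝ)) ((1, 0, 0) : ℝ × ℝ × ℝ) r :=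
    (hasDerivAt_id r).prodMk ((hasDerivAt_const r z).prodMk (hasDerivAt_const r s))
  have hcz : HasDerivAt (fun z' : ℝ => ((r, z', s) : ℝ × ℝ × ℝ)) ((0, 1, 0) : ℝ × ℝ × ℝ) z :=
    (hasDerivAt_const z r).prodMk ((hasDerivAt_id z).prodMk (hasDerivAt_const z s))
  have h_r : HasDerivAt (fun r' => circ v r' z s) (L (1, 0, 0)) r := by
    have := hdiff.hasFDerivAt.comp_hasDerivAt r hcr
    exact this
  have h_z : HasDerivAt (fun z' => circ v r z' s) (L (0, 1, 0)) z := by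
    have := hdiff.hasFDerivAt.comp_hasDerivAt z hcz
    exact this
  have hLr : L (1, 0, 0) = vortCirc v r z s := h_r.unique (hasDerivAt_circ v hv1 r z)
  have hLz : L (0, 1, 0) = -radVortCirc v r z s := h_z.unique (hasDerivAt_circ_z v hv1 r z)
  -- the curve
  have hγ : HasDerivAt (fun h' : ℝ => ((R + K * h', z₀ + ε * h', s) : ℝ × ℝ × ℝ)) ((K, ε, 0) : ℝ × ℝ × ℝ) h := by
    have h1 : HasDerivAt (fun h' : ℝ => R + K * h') K h := by
      simpa using ((hasDerivAt_id h).const_mul K).const_add R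
    have h2 : HasDerivAt (fun h' : ℝ => z₀ + ε * h') ε h := by
      simpa using ((hasDerivAt_id h).const_mul ε).const_add z₀
    exact h1.prodMk (h2.prodMk (hasDerivAt_const h s))
  have hcomp : HasDerivAt (fun h' => circ v (R + K * h') (z₀ + ε * h') s) (L (K, ε, 0)) h := by
    have hd' : DifferentiableAt ℝ F (R + K * h, z₀ + ε * h, s) := hdiff
    have := hd'.hasFDerivAt.comp_hasDerivAt h hγ
    exact this
  have hlin : L (K, ε, 0) = K * L (1, 0, 0) + ε * L (0, 1, 0) := by
    have e : ((K, ε, 0) : ℝ × ℝ × ℝ) = K • ((1, 0, 0) : ℝ × ℝ × ℝ) + ε • ((0, 1, 0) : ℝ × ℝ × ℝ) := by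
      ext <;> simp
    rw [e, map_add, map_smul, map_smul, smul_eq_mul, smul_eq_mul]
  rw [hlin, hLr, hLz] at hcomp
  convert hcomp using 1
  ring

/-- **`Γ` is non-decreasing along the cone lines `h ↦ (R + Kh, z₀ ± h)`, `h ≥ 0`** (cone `‖ω_h‖ ≤ Kω₃`, `R ≥ 0`, `K ≥ 0`: a coned vortex tube widening at slope `K` loses no flux). -/
theorem circ_coneLine_mono (hv : InDoorClass C v) {K : ℝ} (hK : 0 ≤ K)
    (hcone : ∀ s < 0, ∀ x, Real.sqrt ((curl (v s) x 0) ^ 2 + (curl (v s) x 1) ^ 2) ≤ K * curl (v s) x 2)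
    {s : ℝ} (hs : s < 0) {R : ℝ} (hR : 0 ≤ R) (z₀ : ℝ) {ε : ℝ} (hε : ε = 1 ∨ ε = -1) :
    MonotoneOn (fun h => circ v (R + K * h) (z₀ + ε * h) s) (Ici 0) := by
  have hv1 := contDiff_one_slice hv hs
  have hd := fun h => hasDerivAt_circ_line hv hs R K z₀ ε h
  refine monotoneOn_of_deriv_nonneg (convex_Ici 0) ?_ ?_ fun h hh => ?_
  · exact (continuous_iff_continuousAt.2 fun h => (hd h).continuousAt).continuousOn
  · intro h _; exact (hd h).differentiableAt.differentiableWithinAt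
  · rw [interior_Ici] at hh
    rw [(hd h).deriv]
    have hr0 : 0 ≤ R + K * h := by have := le_of_lt (mem_Ioi.1 hh); positivity
    have h1 := abs_radVortCirc_le hv1 hr0 (z₀ + ε * h)
    have h2 := tiltCirc_le_of_cone hv hcone hs hr0 (z₀ + ε * h)
    have h3 := (abs_le.1 (h1.trans h2))
    rcases hε with e | e <;> subst e <;> nlinarith [h3.1, h3.2]

/-! ### Saturated circulation ⇒ vanishing vorticity -/

/-- The tree's circle tool with a constant in place of zero: if `Γ(·, z, s)` is locally CONSTANT near `r > 0` and the circle cone holds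
at `(r,z)`, then `curl v(s) = 0` on the circle (angles in `(0, 2π)`). -/
theorem curl_eq_zero_on_circle_of_const {s : ℝ} (hv : ContDiff ℝ 1 (v s))
    (hsign : ∀ y, 0 ≤ ⟪curl (v s) y, Summit.NavierStokesRegularity.NavierStokesRegularity.Theorems.AxisTwistDoorAveragedConeLiouvilleDefs.e3⟫)
    {K r z c : ℝ} (hr : 0 < r) (hcone : tiltCirc v r z s ≤ K * vortCirc v r z s)
    (hcirc : (fun r' => circ v r' z s) =ᶠ[𝓝 r] fun _ => c) {θ : ℝ} (hθ : θ ∈ Ioo (0 : ℝ) (2 * Real.pi)) :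
    curl (v s) (cylPt r θ z) = 0 := by
  have hvort : vortCirc v r z s = 0 := by
    rw [← deriv_circ_eq_vortCirc v hv r z, hcirc.deriv_eq, deriv_const]
  have hp := continuous_cylPt_θ r z
  have hωc : Continuous fun θ => curl (v s) (cylPt r θ z) := by
    have hD : Continuous (fderiv ℝ (v s)) := hv.continuous_fderiv one_ne_zero
    have e : curl (v s) = fun x => curlCLM (fderiv ℝ (v s) x) := by funext x; exact curl_eq_curlCLM (v s) x
    rw [e]
    exact (curlCLM.continuous.comp hD).comp hp
  have h3 : ∀ θ ∈ Ioo (0 : ℝ) (2 * Real.pi),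
      ⟪curl (v s) (cylPt r θ z), Summit.NavierStokesRegularity.NavierStokesRegularity.Theorems.AxisTwistDoorAveragedConeLiouvilleDefs.e3⟫ = 0 := by
    intro θ' hθ'
    have hfc : Continuous fun θ => ⟪curl (v s) (cylPt r θ z),
        Summit.NavierStokesRegularity.NavierStokesRegularity.Theorems.AxisTwistDoorAveragedConeLiouvilleDefs.e3⟫ * r :=
      (hωc.inner continuous_const).mul continuous_const
    have hint : ∫ θ in (0 : ℝ)..(2 * Real.pi), ⟪curl (v s) (cylPt r θ z),
        Summit.NavierStokesRegularity.NavierStokesRegularity.Theorems.AxisTwistDoorAveragedConeLiouvilleDefs.e3⟫ * r = 0 := hvort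
    have h := eq_zero_of_integral_eq_zero_of_nonneg hfc (fun θ => mul_nonneg (hsign _) hr.le) hint hθ'
    exact (mul_eq_zero.1 h).resolve_right hr.ne'
  have htilt0 : tiltCirc v r z s = 0 := by
    have hle : tiltCirc v r z s ≤ 0 := by rw [hvort, mul_zero] at hcone; exact hcone
    have hge : 0 ≤ tiltCirc v r z s :=
      intervalIntegral.integral_nonneg (by positivity) fun θ _ => mul_nonneg (norm_nonneg _) hr.le
    exact le_antisymm hle hge
  have hh : curl (v s) (cylPt r θ z) - ⟪curl (v s) (cylPt r θ z),
      Summit.NavierStokesRegularity.NavierStokesRegularity.Theorems.AxisTwistDoorAveragedConeLiouvilleDefs.e3⟫ •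
        Summit.NavierStokesRegularity.NavierStokesRegularity.Theorems.AxisTwistDoorAveragedConeLiouvilleDefs.e3 = 0 := by
    have hdc : Continuous fun θ => curl (v s) (cylPt r θ z) - ⟪curl (v s) (cylPt r θ z),
        Summit.NavierStokesRegularity.NavierStokesRegularity.Theorems.AxisTwistDoorAveragedConeLiouvilleDefs.e3⟫ •
          Summit.NavierStokesRegularity.NavierStokesRegularity.Theorems.AxisTwistDoorAveragedConeLiouvilleDefs.e3 :=
      continuous_horizontal.comp hωc
    have hgc := (hdc.norm).mul (continuous_const (y := r))
    have hint : ∫ θ in (0 : ℝ)..(2 * Real.pi), ‖curl (v s) (cylPt r θ z) - ⟪curl (v s) (cylPt r θ z),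
        Summit.NavierStokesRegularity.NavierStokesRegularity.Theorems.AxisTwistDoorAveragedConeLiouvilleDefs.e3⟫ •
          Summit.NavierStokesRegularity.NavierStokesRegularity.Theorems.AxisTwistDoorAveragedConeLiouvilleDefs.e3‖ * r = 0 := htilt0
    have h := eq_zero_of_integral_eq_zero_of_nonneg hgc (fun θ => mul_nonneg (norm_nonneg _) hr.le) hint hθ
    exact norm_eq_zero.1 ((mul_eq_zero.1 h).resolve_right hr.ne')
  rwa [h3 θ hθ, zero_smul, sub_zero] at hh

/-- **SUPPORT RIGIDITY.**  A closed-hemisphere door-class profile in the cone `‖ω_h‖ ≤ Kω₃` whose axis circulation on ONE slice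
`s₀ < 0` is SATURATED by one disc — `Γ(R, z₀, s₀) = S` with `Γ(r, z, s₀) ≤ S` for all `r ≥ 0`, `z` — vanishes identically. -/
theorem eq_zero_of_saturated (hv : InDoorClass C v) (hsign : SignE3 v) {K : ℝ} (hK : 0 ≤ K)
    (hcone : ∀ s < 0, ∀ x, Real.sqrt ((curl (v s) x 0) ^ 2 + (curl (v s) x 1) ^ 2) ≤ K * curl (v s) x 2)
    {s₀ : ℝ} (hs₀ : s₀ < 0) {R z₀ S : ℝ} (hR : 0 ≤ R) (hsat : circ v R z₀ s₀ = S)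
    (hle : ∀ r : ℝ, 0 ≤ r → ∀ z : ℝ, circ v r z s₀ ≤ S) :
    ∀ t < 0, ∀ x, v t x = 0 := by
  have hv1 := contDiff_one_slice hv hs₀
  have hsign' : ∀ y, 0 ≤ ⟪curl (v s₀) y,
      Summit.NavierStokesRegularity.NavierStokesRegularity.Theorems.AxisTwistDoorAveragedConeLiouvilleDefs.e3⟫ :=
    fun y => signE3_atd hsign s₀ hs₀ y
  -- along the cone lines the disc stays saturated: `Γ(R + K|z − z₀|, z, s₀) = S`
  have hline : ∀ z : ℝ, circ v (R + K * |z - z₀|) z s₀ = S := by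
    intro z
    refine le_antisymm (hle _ (by positivity) z) ?_
    rcases le_or_gt z₀ z with hz | hz
    · have h := circ_coneLine_mono hv hK hcone hs₀ hR z₀ (ε := 1) (Or.inl rfl) (self_mem_Ici)
        (mem_Ici.2 (sub_nonneg.2 hz)) (sub_nonneg.2 hz)
      have e1 : circ v (R + K * 0) (z₀ + 1 * 0) s₀ = S := by rw [mul_zero, add_zero, mul_zero, add_zero, hsat]
      have e2 : circ v (R + K * (z - z₀)) (z₀ + 1 * (z - z₀)) s₀ = circ v (R + K * |z - z₀|) z s₀ := by
        rw [abs_of_nonneg (sub_nonneg.2 hz), one_mul, add_sub_cancel]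
      have h' : circ v (R + K * 0) (z₀ + 1 * 0) s₀ ≤ circ v (R + K * (z - z₀)) (z₀ + 1 * (z - z₀)) s₀ := h
      rw [e1, e2] at h'
      exact h'
    · have h := circ_coneLine_mono hv hK hcone hs₀ hR z₀ (ε := -1) (Or.inr rfl) (self_mem_Ici)
        (mem_Ici.2 (sub_nonneg.2 hz.le)) (sub_nonneg.2 hz.le)
      have e1 : circ v (R + K * 0) (z₀ + -1 * 0) s₀ = S := by rw [mul_zero, add_zero, mul_zero, add_zero, hsat]
      have e2 : circ v (R + K * (z₀ - z)) (z₀ + -1 * (z₀ - z)) s₀ = circ v (R + K * |z - z₀|) z s₀ := by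
        rw [abs_of_neg (sub_neg.2 hz), neg_sub, show z₀ + -1 * (z₀ - z) = z by ring]
      have h' : circ v (R + K * 0) (z₀ + -1 * 0) s₀ ≤ circ v (R + K * (z₀ - z)) (z₀ + -1 * (z₀ - z)) s₀ := h
      rw [e1, e2] at h'
      exact h'
  -- beyond the cone line `Γ(·, z, s₀) ≡ S`
  have hconst : ∀ z r : ℝ, R + K * |z - z₀| ≤ r → circ v r z s₀ = S := fun z r hr =>
    le_antisymm (hle r ((by positivity : (0:ℝ) ≤ R + K * |z - z₀|).trans hr) z)
      ((hline z).symm.le.trans (circ_mono v hv1 (signE3_atd hsign) hs₀ (by positivity) hr z))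
  -- the open vorticity-free region `{y₁ > 0, (R + K|y₂ − z₀| + 1)² < y₀² + y₁²}`
  set U : Set (EuclideanSpace ℝ (Fin 3)) := {y | 0 < y 1 ∧ (R + K * |y 2 - z₀| + 1) ^ 2 < y 0 ^ 2 + y 1 ^ 2} with hU
  have hcont_yi : ∀ i : Fin 3, Continuous fun y : EuclideanSpace ℝ (Fin 3) => y i := fun i =>
    (continuous_apply i).comp (PiLp.continuous_ofLp 2 _)
  have hUo : IsOpen U := by
    refine (isOpen_lt continuous_const (hcont_yi 1)).inter (isOpen_lt ?_ (((hcont_yi 0).pow 2).add ((hcont_yi 1).pow 2)))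
    exact ((continuous_const.add (continuous_const.mul (((hcont_yi 2).sub continuous_const).abs))).add continuous_const).pow 2
  have hUne : U.Nonempty := by
    refine ⟨cylPt (R + 2) (Real.pi / 2) z₀, ?_, ?_⟩
    · show 0 < (cylPt (R + 2) (Real.pi / 2) z₀) 1
      simp [cylPt]; linarith
    · show (R + K * |(cylPt (R + 2) (Real.pi / 2) z₀) 2 - z₀| + 1) ^ 2 <
        (cylPt (R + 2) (Real.pi / 2) z₀) 0 ^ 2 + (cylPt (R + 2) (Real.pi / 2) z₀) 1 ^ 2
      simp [cylPt]; nlinarith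
  refine eq_zero_of_curl_eq_zero_on_open hv.1 hv.2.1 hv.2.2.1 hv.2.2.2 hs₀ hUo hUne fun y hy => ?_
  obtain ⟨hy1, hy2⟩ := hy
  obtain ⟨r, θ, hr, hr2, hθ, hyeq⟩ := exists_cylPt_eq hy1
  have hy2' : (R + K * |y 2 - z₀| + 1) ^ 2 < r ^ 2 := by rw [hr2]; exact hy2
  have hRr : R + K * |y 2 - z₀| + 1 < r := by
    have h0 : 0 ≤ R + K * |y 2 - z₀| + 1 := by positivity
    nlinarith
  rw [← hyeq]
  refine curl_eq_zero_on_circle_of_const hv1 hsign' hr (tiltCirc_le_of_cone hv hcone hs₀ hr.le (y 2)) (c := S) ?_ hθ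
  filter_upwards [Ioi_mem_nhds (show R + K * |y 2 - z₀| < r by linarith)] with r' hr'
  exact hconst (y 2) r' (le_of_lt hr')

end Summit.NavierStokesRegularity.NavierStokesRegularity.Theorems.HalfSpaceWindowDoorCirculationCarryingRigidityConeSupportRigidity

end
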